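import Summits.BirchSwinnertonDyer.BirchSwinnertonDyer.Theorems.ByReductionTypeAtTwoTorsionEulerCharB6ScheduleInputs
import HarnessLib

set_option linter.dupNamespace false -- `…BirchSwinnertonDyer.BirchSwinnertonDyer…` is the cell's nested layout (D-0017)
set_option autoImplicit false

/-!
# H46 kernel programme (road C′), brick B6 — the finite-coefficient SCHEDULE: the reduced corestriction of a deep-layer class whose
# push is Selmer over `ℚ_∞` vanishes (socket (HB6) of `H46Assembly.exists_realiser_of_sockets` at a deep layer, NO hypothesis (T₁))

Cell `bsd-2adic` (run/shared/lean/pub/bsd-2adic/), seat `bsd-2adic-tower-1` GEN 38; `--supports stmt-BirchSwinnertonDyer-19271`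
(helper, item `OrdKatoHalfAtTwo`, TOWER road). THEOREMS ONLY (no definition, no named fact, no instance, no `sorry`); closes no
item; nothing booked; BSD is not proved by any of this. Schedule of record: `HOME/tower/gen38/NOTE-B6-SCHEDULE-GEN38.md`.

`exists_layer_cores_reduce_eq_zero`: for `E/ℚ` good ORDINARY at `p`, `κ` cyclotomic, `Sel_{p^∞}(E/ℚ)` finite, there is a layer `n*`
such that for every `c'` there is `c` with: for all `j`, `N ≥ c + j`, every equivariant `r : E[p^N] → E[p^j]` (`P ↦ p^{N-j}P`) and every
`b ∈ H¹(Γ_{n*}, E[p^N])` with `p^{c'} · h_{n*}(push b) ∈ Sel_{p^∞}(E/ℚ_∞)`: `cor_{Γ_{n*}→Γ_ℚ} (r_* b) = 0` in `H¹(Γ_ℚ, E[p^j])`. This is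
Greenberg's universal-norm input of Lemma 4.6 WITHOUT the side condition (T₁) of the level-`0` theorem
`H46LevelZero.exists_cores_reduce_eq_zero` (p741580). What remains for `H46` unconditional (recorded, not claimed): the layer-`n*`
Selmer membership of the ♭-dual classes of the B4 call with unramified sockets at the bad places and an auxiliary place `v₀` split in
`ℚ_{n*}`, then the glue `lemma46At` (GEN 35 `lemma46At_of_T1` with `n := n*`).
[cite: GreenbergLNM1716, §4 Lemma 4.6 (pp. 105–108), Thm. 1.2, §3 Lemma 3.1] [cite: PerrinRiou1987BSMF, §0 p. 402]
-/

noncomputable section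

open scoped Classical NumberField ContRepresentation

namespace Summit.BirchSwinnertonDyer.BirchSwinnertonDyer.Theorems

namespace TorsionEulerChar.B6

open CategoryTheory Field NumberField IsDedekindDomain WeierstrassCurve
  Literature.NumberTheory.EllipticCurves Literature.NumberTheory.EllipticCurves.CyclotomicLayer
  Literature.NumberTheory.EllipticCurves.GreenbergSelmer
  Literature.NumberTheory.GaloisRepresentations Literature.NumberTheory.GaloisRepresentations.DiscreteGaloisModule
  Literature.NumberTheory.GaloisCohomology ZpExtension
open _root_.TopRep _root_.ContinuousCohomology
open Literature.Algebra.Homology.DiscreteRep (toTopRepHom)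

/-! ### Naturality of the restriction in the coefficients (generic) -/

section Generic

universe u v

variable {R : Type u} [CommRing R] [TopologicalSpace R]
variable {G : Type v} [Group G] [TopologicalSpace G] [IsTopologicalGroup G]

/-- **`H¹(f)` commutes with `res_{H/H′}`** for a morphism `f : X ⟶ Y` of topological representations and `H ≤ H′`. [folklore] -/
theorem cohomologyMap_resLe {X Y : TopRep.{v} R G} (f : X ⟶ Y) {H H' : Subgroup G} (h : H ≤ H')
    (c : continuousCohomology 1 (subgroupRep X H')) :
    cohomologyMap (subgroupRepHom f H) 1 (resLe X h 1 c) = resLe Y h 1 (cohomologyMap (subgroupRepHom f H') 1 c) := by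
  obtain ⟨φ, rfl⟩ := oneCocycleClass_surjective _ c
  rw [resLe_oneCocycleClass, cohomologyMap_oneCocycleClass, cohomologyMap_oneCocycleClass, resLe_oneCocycleClass]
  exact congrArg _ (Subtype.ext (ContinuousMap.ext fun _ ↦ rfl))

omit [TopologicalSpace G] [IsTopologicalGroup G] in
/-- Restricting `subgroupRepHom f H′` further to `H ≤ H′` is `subgroupRepHom f H` (definitional). [folklore] -/
theorem restrictHomOfLe_subgroupRepHom {X Y : TopRep.{v} R G} (f : X ⟶ Y) {H H' : Subgroup G} (h : H ≤ H') :
    restrictHomOfLe h (subgroupRepHom f H') = subgroupRepHom f H := rfl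

end Generic

/-! ## §2′ `cor` of principal classes of deep layers vanishes (the `(p : ℤ) ^ L` dialect) -/

section PrincipalPow

variable (W : WeierstrassCurve ℚ) [W.IsElliptic] (p : ℕ) [hp : Fact p.Prime] (κ : ZpExtension ℚ p)

/-- **`cor_{Γ_m → Γ_ℚ}` kills the principal classes of `H¹(Γ_m, E[p^L])` for `m ≫ 0`** — the `(p : ℤ) ^ L` /
`discreteTopRep`-dialect form of `…B6Principal.exists_forall_cores_eq_zero_of_forall_eq_sub` (same proof: the norm of `Q` lies in
`E[p^L]` by the arbitrary-transversal torsion-norm lemma). [cite: GreenbergLNM1716, §4 Lemma 4.6 (pp. 105–108)]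
[cite: NeukirchSchmidtWingberg2008, I §5 (1.5.2)] -/
theorem exists_forall_cores_eq_zero_of_forall_eq_sub_pow :
    ∃ m₁ : ℕ, ∀ m : ℕ, m₁ ≤ m → ∀ [Fintype (absoluteGaloisGroup ℚ ⧸ κ.layerSubgroup m)] (L : ℕ)
      (ι : (W.torsionGaloisModule ((p : ℤ) ^ L)).toTopRep ⟶ discreteTopRep (absoluteGaloisGroup ℚ) (W.geomPrimaryTorsion p))
      (_hι : ∀ P : W.geomTorsion ((p : ℤ) ^ L), ((ι.hom P : W.geomPrimaryTorsion p) : W.geomPoints) = (P : W.geomPoints))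
      (g : contOneCocycles (discreteTopRep (κ.layerSubgroup m) (W.geomTorsion ((p : ℤ) ^ L))))
      (Q : W.geomPrimaryTorsion p),
      (∀ n : κ.layerSubgroup m, ((g.1 n : W.geomTorsion ((p : ℤ) ^ L)) : W.geomPoints) =
        (n : absoluteGaloisGroup ℚ) • (Q : W.geomPoints) - (Q : W.geomPoints)) →
      cores (W.torsionGaloisModule ((p : ℤ) ^ L)).toTopRep (κ.layerSubgroup m) (κ.isOpen_layerSubgroup m)
        (oneCocycleClass (discreteTopRep (κ.layerSubgroup m) (W.geomTorsion ((p : ℤ) ^ L))) g) = 0 := by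
  obtain ⟨m₁, hm₁⟩ := exists_forall_sum_smul_eq_zero_of_fixed W p κ
  refine ⟨m₁, fun m hm _ L ι hι g Q hg ↦ ?_⟩
  have hιinj : Function.Injective ι.hom := fun P P' h ↦ Subtype.ext (by rw [← hι P, ← hι P', h])
  have hg' : ∀ n : κ.layerSubgroup m, ι.hom (g.1 n) = (n : absoluteGaloisGroup ℚ) • Q - Q := fun n ↦
    Subtype.ext (by rw [hι, hg, AddSubgroupClass.coe_sub, Literature.NumberTheory.EllipticCurves.primaryComponent.coe_smul])
  -- `t = p^L • Q` is fixed by `Γ_m`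
  have hsmulM : ∀ n : κ.layerSubgroup m, p ^ L • ((n : absoluteGaloisGroup ℚ) • Q - Q) = 0 := fun n ↦ by
    rw [← hg' n]
    apply Subtype.ext
    rw [AddSubgroupClass.coe_nsmul, hι, ZeroMemClass.coe_zero, ← natCast_zsmul, Nat.cast_pow]
    exact (mem_geomTorsion_iff W _ _).mp (g.1 n).2
  have hfix : ∀ σ ∈ κ.layerSubgroup m, σ • (p ^ L • Q) = p ^ L • Q := fun σ hσ ↦ by
    have h := hsmulM ⟨σ, hσ⟩
    rw [nsmul_sub, sub_eq_zero] at h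
    rw [smul_comm, h]
  have hnorm : ∑ x : absoluteGaloisGroup ℚ ⧸ κ.layerSubgroup m, Quotient.out x • (p ^ L • Q) = 0 :=
    hm₁ m hm QuotientGroup.out_eq' (p ^ L • Q) hfix
  have hmem : ((∑ x : absoluteGaloisGroup ℚ ⧸ κ.layerSubgroup m, Quotient.out x • Q : W.geomPrimaryTorsion p) : W.geomPoints) ∈
      W.geomTorsion ((p : ℤ) ^ L) := by
    rw [mem_geomTorsion_iff, ← Nat.cast_pow, natCast_zsmul, ← AddSubgroupClass.coe_nsmul, Finset.smul_sum]
    simp_rw [smul_comm (p ^ L : ℕ)]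
    rw [hnorm, ZeroMemClass.coe_zero]
  refine cores_eq_zero_of_forall_eq_sub_of_sum_eq (X := (W.torsionGaloisModule ((p : ℤ) ^ L)).toTopRep) (κ.layerSubgroup m)
    (κ.isOpen_layerSubgroup m) QuotientGroup.out_eq' ι hιinj g Q hg' ⟨_, hmem⟩ (Subtype.ext ?_)
  rw [hι]
  rfl

end PrincipalPow

/-! ## §3 The schedule: socket (HB6) at a deep layer without (T₁) -/

section Schedule

variable (W : WeierstrassCurve ℚ) [W.IsElliptic] [W.IsGloballyMinimal] (p : ℕ) [hp : Fact p.Prime] (κ : ZpExtension ℚ p)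
  (hκ : κ.IsCyclotomic) (hord : IsOrdinaryAt W p)

set_option maxHeartbeats 400000 in -- the final decl check of this long proof needs ≈2× the default
include hκ hord in
/-- **(HB6) at a deep layer, WITHOUT the side condition (T₁): the reduced corestriction `cor_{Γ_{n*}→Γ_ℚ} (r_* b) = 0` for every layer class
`b ∈ H¹(Γ_{n*}, E[p^N])` whose push, up to `p^{c'}`, is Selmer over `ℚ_∞`.** Hypotheses: `E/ℚ` (globally minimal `W`) good ORDINARY at `p`,
`κ` cyclotomic, `Sel_{p^∞}(E/ℚ)` finite. Conclusion: there is a layer `n*` such that for every `c'` there is `c` with: for all `j`, all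
`N ≥ c + j`, every equivariant `r : E[p^N] → E[p^j]` with values `p^{N-j}·P`, and every `b ∈ H¹(Γ_{n*}, E[p^N])` with
`p^{c'} · h_{n*}(push b) ∈ Sel_{p^∞}(E/ℚ_∞)`: `cor_{Γ_{n*}→Γ_ℚ} (r_* b) = 0` in `H¹(Γ_ℚ, E[p^j])`. This is the universal-norm content of
Greenberg's Lemma 4.6 (the compact Selmer tower has no universal norms in `E(ℚ)(p)`), proved by the finite-coefficient schedule of
`HOME/tower/gen38/NOTE-B6-SCHEDULE-GEN38.md`: stabilisation `p^f·Sel_∞^{Γ_{n*}} ⊆ Sel_∞^{Γ_n}` (brick S), Mazur control at the layer `n`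
(brick U1), the `B`-valued description of `ker h_m` (brick `…B6Principal`: killed by `p^e`, hence no multiplication of `b` is ever needed),
Kummer lifts (brick K), `cor ∘ res = p^a` between the layers `n < n* = n + a` (brick C), «`cor` of principal classes of deep layers
vanishes» (torsion norms), and `p^{e₂} · cor_{Γ_n→Γ}(Sel(E/ℚ_n)) = 0` (§2). No (T₁), no Λ-adic duality, no inverse limits.
[cite: GreenbergLNM1716, §4 Lemma 4.6 (pp. 105–108), Thm. 1.2, §3 Lemma 3.1] [cite: PerrinRiou1987BSMF, §0 p. 402] -/
theorem exists_layer_cores_reduce_eq_zero [Finite (W.selmerGroupPInfty p)] :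
    ∃ nstar : ℕ, ∀ c' : ℕ, ∃ c : ℕ, ∀ (j N : ℕ), c + j ≤ N →
      ∀ [Fintype (absoluteGaloisGroup ℚ ⧸ κ.layerSubgroup nstar)]
      (r : (W.torsionGaloisModule ((p : ℤ) ^ N)).toContRepresentation →ⁱL
        (W.torsionGaloisModule ((p : ℤ) ^ j)).toContRepresentation)
      (_hr : ∀ P : W.geomTorsion ((p : ℤ) ^ N),
        ((r P : W.geomTorsion ((p : ℤ) ^ j)) : W.geomPoints) = (p : ℤ) ^ (N - j) • (P : W.geomPoints))
      (b : W.torsionH1Over ((p : ℤ) ^ N) (κ.layerSubgroup nstar)),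
      p ^ c' • W.layerToInfty κ nstar (resH1Hom (N := W.geomPrimaryTorsion p) (subgroupInclusion (le_refl _))
          (AddSubgroup.inclusion (AcSigned.geomTorsion_zpow_le_geomPrimaryTorsion W p N)) (fun _ _ ↦ rfl) b) ∈ W.selmerInfty κ →
      cores (W.torsionGaloisModule ((p : ℤ) ^ j)).toTopRep (κ.layerSubgroup nstar) (κ.isOpen_layerSubgroup nstar)
        (cohomologyMap (subgroupRepHom (toTopRepHom (W.torsionGaloisModule ((p : ℤ) ^ N))
          (W.torsionGaloisModule ((p : ℤ) ^ j)) r) (κ.layerSubgroup nstar)) 1 b) = 0 := by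
  have hfin : Finite (W.selmerGroupPInfty p) := ‹_›
  haveI : CompactSpace (absoluteGaloisGroup ℚ) := absoluteGaloisGroup_compactSpace ℚ
  have hp' : ∀ v : HeightOneSpectrum (𝓞 ℚ), (p : 𝓞 ℚ) ∈ v.asIdeal → W.HasGoodReductionAt v ∧ W.HasUnitRootAt v :=
    fun v hv ↦ W.hasGoodReductionAt_and_hasUnitRootAt_of_rat hord.1 hord.2 v hv
  -- the dual datum, finitely generated and torsion
  obtain ⟨γ, hγ⟩ := κ.exists_isTopGenerator
  haveI hfg : Module.Finite (IwasawaAlgebra p) (W.selmerDualData κ hγ).X := (W.selmerDualData κ hγ).module_finite_holds hγ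
  have hT : (W.selmerDualData κ hγ).IsTorsion := GoodOrdTower.isTorsion_of_finite_selmerGroup_all W κ _ hκ hp' hγ hfin
  -- uniform exponents
  obtain ⟨e, he⟩ := exists_pow_nsmul_eq_zero_of_resOfLe_kerSubgroup_eq_zero W p κ
  obtain ⟨e', he'⟩ := exists_pow_nsmul_eq_zero_of_mem_fixedPoints W p κ
  obtain ⟨m₁, hm₁⟩ := exists_forall_cores_eq_zero_of_forall_eq_sub_pow W p κ
  obtain ⟨e₂, he₂⟩ := exists_pow_nsmul_cores_eq_zero_of_mem_selmerLayer W p κ hκ hord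
  -- stabilisation (brick S) with step `a = e + e'` from the level `m₁` on
  obtain ⟨i, f, hS⟩ := exists_pow_smul_layerInvariants_subset W p κ (W.selmerDualData κ hγ) hfg hT hγ
    (fun m ↦ (W.layerInvariants κ m).comap (W.selmerInfty κ).subtype) (fun _ _ ↦ Iff.rfl) (e + e') m₁
  refine ⟨m₁ + (i + 1) * (e + e'), fun c' ↦ ?_⟩
  -- control cokernel exponent at the lower layer `n`
  obtain ⟨c₀, hc₀⟩ := exists_pow_nsmul_mem_map_selmerLayer W p κ (GoodOrdTower.selmer_control_all W κ) hκ hp' (m₁ + i * (e + e'))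
  refine ⟨(c' + f + c₀) + e₂ + e, fun j N hN _ r hr b hsel ↦ ?_⟩
  -- the two layers `Γ_{n*} ≤ Γ_n`
  have hle : κ.layerSubgroup (m₁ + (i + 1) * (e + e')) ≤ κ.layerSubgroup (m₁ + i * (e + e')) :=
    κ.layerSubgroup_antitone (by nlinarith)
  haveI : Finite (absoluteGaloisGroup ℚ ⧸ κ.layerSubgroup (m₁ + i * (e + e'))) :=
    Subgroup.quotient_finite_of_isOpen _ (κ.isOpen_layerSubgroup _)
  haveI : Fintype (absoluteGaloisGroup ℚ ⧸ κ.layerSubgroup (m₁ + i * (e + e'))) := Fintype.ofFinite _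
  have hidx : ((κ.layerSubgroup (m₁ + (i + 1) * (e + e'))).subgroupOf (κ.layerSubgroup (m₁ + i * (e + e')))).index =
      p ^ (e + e') := by
    have hrel : (κ.layerSubgroup (m₁ + (i + 1) * (e + e'))).relIndex (κ.layerSubgroup (m₁ + i * (e + e'))) *
        p ^ (m₁ + i * (e + e')) = p ^ (m₁ + (i + 1) * (e + e')) := by
      rw [← κ.index_layerSubgroup, ← κ.index_layerSubgroup]; exact Subgroup.relIndex_mul_index hle
    have h : (κ.layerSubgroup (m₁ + (i + 1) * (e + e'))).relIndex (κ.layerSubgroup (m₁ + i * (e + e'))) =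
        p ^ (m₁ + (i + 1) * (e + e')) / p ^ (m₁ + i * (e + e')) :=
      (Nat.div_eq_of_eq_mul_left (pow_pos hp.out.pos _) hrel.symm).symm
    change (κ.layerSubgroup (m₁ + (i + 1) * (e + e'))).relIndex (κ.layerSubgroup (m₁ + i * (e + e'))) = _
    rw [h, Nat.pow_div (by nlinarith) hp.out.pos]
    congr 1
    rw [add_mul, one_mul]; omega
  haveI : ((κ.layerSubgroup (m₁ + (i + 1) * (e + e'))).subgroupOf (κ.layerSubgroup (m₁ + i * (e + e')))).FiniteIndex :=
    ⟨by rw [hidx]; exact pow_ne_zero _ hp.out.ne_zero⟩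
  haveI : Fintype (κ.layerSubgroup (m₁ + i * (e + e')) ⧸
      (κ.layerSubgroup (m₁ + (i + 1) * (e + e'))).subgroupOf (κ.layerSubgroup (m₁ + i * (e + e')))) := Fintype.ofFinite _
  /- ### (1)–(3): from `p^{c'} h_{n*}(push b) ∈ Sel_∞` to a Selmer class `Y` of the layer `n` with `h_n Y = p^{e₁} h_{n*}(push b)` -/
  have hb0 : p ^ N • b = 0 := by
    have h := TorsionEulerChar.H46LevelZero.zsmul_torsionH1Over_eq_zero W (p ^ N) (κ.layerSubgroup (m₁ + (i + 1) * (e + e')))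
    rw [Nat.cast_pow] at h
    exact h b
  have hTinv : p ^ c' • W.layerToInfty κ (m₁ + (i + 1) * (e + e')) (resH1Hom (N := W.geomPrimaryTorsion p)
      (subgroupInclusion (le_refl _)) (AddSubgroup.inclusion (AcSigned.geomTorsion_zpow_le_geomPrimaryTorsion W p N))
      (fun _ _ ↦ rfl) b) ∈ W.layerInvariants κ (m₁ + (i + 1) * (e + e')) :=
    AddSubgroup.nsmul_mem _ (W.range_layerToInfty_le_layerInvariants_holds κ _ ⟨_, rfl⟩) _
  have h2 : p ^ f • (p ^ c' • W.layerToInfty κ (m₁ + (i + 1) * (e + e')) (resH1Hom (N := W.geomPrimaryTorsion p)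
      (subgroupInclusion (le_refl _)) (AddSubgroup.inclusion (AcSigned.geomTorsion_zpow_le_geomPrimaryTorsion W p N))
      (fun _ _ ↦ rfl) b)) ∈ W.layerInvariants κ (m₁ + i * (e + e')) := by
    have h := hS (p ^ f • ⟨_, hsel⟩) (AddSubgroup.nsmul_mem _ hTinv _) ⟨⟨_, hsel⟩, hTinv, rfl⟩
    exact h
  obtain ⟨Y, hYsel, hY⟩ := (AddSubgroup.mem_map).1 (hc₀ _ ⟨AddSubgroup.nsmul_mem _ hsel _, h2⟩)
  have hY' : W.layerToInfty κ (m₁ + i * (e + e')) Y = p ^ (c' + f + c₀) • W.layerToInfty κ (m₁ + (i + 1) * (e + e'))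
      (resH1Hom (N := W.geomPrimaryTorsion p) (subgroupInclusion (le_refl _))
        (AddSubgroup.inclusion (AcSigned.geomTorsion_zpow_le_geomPrimaryTorsion W p N)) (fun _ _ ↦ rfl) b) := by
    rw [hY, smul_smul, smul_smul, ← pow_add, ← pow_add]
    congr 2; ring
  -- abbreviations for the push of `b` and its restriction to `ℚ_∞`
  set β : W.subgroupH1 p (κ.layerSubgroup (m₁ + (i + 1) * (e + e'))) := resH1Hom (N := W.geomPrimaryTorsion p)
    (subgroupInclusion (le_refl _)) (AddSubgroup.inclusion (AcSigned.geomTorsion_zpow_le_geomPrimaryTorsion W p N))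
    (fun _ _ ↦ rfl) b with hβ
  set T : W.subgroupH1 p κ.kerSubgroup := W.layerToInfty κ (m₁ + (i + 1) * (e + e')) β with hTdef
  have hβ0 : p ^ N • β = 0 := by rw [hβ, ← map_nsmul, hb0, map_zero]
  have hT0 : p ^ N • T = 0 := by rw [hTdef, ← map_nsmul, hβ0, map_zero]
  /- ### (4) `θ = res Y − p^{e₁} β` dies over `ℚ_∞`, hence is killed by `p^e` -/
  have hcomp : ∀ y : W.subgroupH1 p (κ.layerSubgroup (m₁ + i * (e + e'))),
      W.layerToInfty κ (m₁ + (i + 1) * (e + e')) (W.resOfLe p hle y) = W.layerToInfty κ (m₁ + i * (e + e')) y := fun y ↦ by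
    rw [WeierstrassCurve.layerToInfty, WeierstrassCurve.layerToInfty, ← AddMonoidHom.comp_apply, W.resOfLe_comp_holds p]
  have hθ : p ^ e • (W.resOfLe p hle Y - p ^ (c' + f + c₀) • β) = 0 := by
    refine he (κ.kerSubgroup_le_layerSubgroup _) _ ?_
    change W.layerToInfty κ _ _ = 0
    rw [map_sub, map_nsmul, hcomp, hY', sub_self]
  /- ### (5) `p^d · res Y = p^{N-j} · β` with `d = N - e₁ - j ≥ e` -/
  have hd : e ≤ N - (c' + f + c₀) - j := by omega
  have h5 : p ^ (N - (c' + f + c₀) - j) • W.resOfLe p hle Y = p ^ (N - j) • β := by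
    obtain ⟨d', hd'⟩ := Nat.exists_eq_add_of_le hd
    have h : p ^ (N - (c' + f + c₀) - j) • (W.resOfLe p hle Y - p ^ (c' + f + c₀) • β) = 0 := by
      rw [hd', pow_add, mul_comm (p ^ e) (p ^ d'), mul_nsmul', hθ, nsmul_zero]
    rw [nsmul_sub, sub_eq_zero] at h
    rw [h, smul_smul, ← pow_add]
    congr 2; omega
  /- ### (6) `Y` has bounded exponent: `p^e · p^{N-e₁} · Y = 0`; Kummer lifts `y♭` (level `j+e`) and `y_j` (level `j`) -/
  have hYtors : p ^ e • (p ^ (N - (c' + f + c₀)) • Y) = 0 := by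
    refine he (κ.kerSubgroup_le_layerSubgroup _) _ ?_
    change W.layerToInfty κ _ _ = 0
    rw [map_nsmul, hY', smul_smul, ← pow_add, Nat.sub_add_cancel (by omega), hT0]
  obtain ⟨yflat, hyflat⟩ := exists_push_eq_of_pow_nsmul_eq_zero W p (κ.layerSubgroup (m₁ + i * (e + e'))) (j + e)
    (p ^ (N - (c' + f + c₀) - j) • Y) (by
      rw [smul_smul, ← pow_add, show j + e + (N - (c' + f + c₀) - j) = e + (N - (c' + f + c₀)) by omega, pow_add,
        mul_nsmul', hYtors])
  obtain ⟨yj, hyj⟩ := exists_push_eq_of_pow_nsmul_eq_zero W p (κ.layerSubgroup (m₁ + i * (e + e'))) j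
    (p ^ (N - (c' + f + c₀) - j + e) • Y) (by
      rw [smul_smul, ← pow_add, show j + (N - (c' + f + c₀) - j + e) = e + (N - (c' + f + c₀)) by omega, pow_add,
        mul_nsmul', hYtors])
  /- ### (7) the inclusions `ι' : E[p^j] ⟶ E[p^{j+e}]`, `ιj : E[p^j] ⟶ E[p^∞]`, `ιje : E[p^{j+e}] ⟶ E[p^∞]` -/
  obtain ⟨ι', hι'⟩ := exists_hom_torsion_torsion W p (Nat.le_add_right j e)
  obtain ⟨ιj, hιj⟩ := exists_hom_torsion_primary W p j
  obtain ⟨ιje, hιje⟩ := exists_hom_torsion_primary W p (j + e)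
  /- ### (8)–(9) `x = ι'_* (r_* b)` and `res y♭` have the same push `p^{N-j} β` -/
  have h9 : resH1Hom (N := W.geomPrimaryTorsion p) (subgroupInclusion (le_refl _))
      (AddSubgroup.inclusion (AcSigned.geomTorsion_zpow_le_geomPrimaryTorsion W p (j + e))) (fun _ _ ↦ rfl)
      (cohomologyMap (subgroupRepHom ι' (κ.layerSubgroup (m₁ + (i + 1) * (e + e')))) 1
        (cohomologyMap (subgroupRepHom (toTopRepHom (W.torsionGaloisModule ((p : ℤ) ^ N))
          (W.torsionGaloisModule ((p : ℤ) ^ j)) r) (κ.layerSubgroup (m₁ + (i + 1) * (e + e')))) 1 b)) =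
      resH1Hom (N := W.geomPrimaryTorsion p) (subgroupInclusion (le_refl _))
        (AddSubgroup.inclusion (AcSigned.geomTorsion_zpow_le_geomPrimaryTorsion W p (j + e))) (fun _ _ ↦ rfl)
        (resLe (W.torsionGaloisModule ((p : ℤ) ^ (j + e))).toTopRep hle 1 yflat) := by
    rw [push_cohomologyMap_incl W p _ ι' hι', push_reduce_eq_pow_nsmul_push W p _ r hr b, push_resLe W p hle (j + e) yflat,
      hyflat, map_nsmul, h5]
  /- ### (10)–(11) after `cor_{n*→n}`: `ι'_* cor (r_* b)` and `cor (res y♭) = p^{e+e'} y♭` have the same push -/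
  have h11 : resH1Hom (N := W.geomPrimaryTorsion p) (subgroupInclusion (le_refl _))
      (AddSubgroup.inclusion (AcSigned.geomTorsion_zpow_le_geomPrimaryTorsion W p (j + e))) (fun _ _ ↦ rfl)
      (cohomologyMap (subgroupRepHom ι' (κ.layerSubgroup (m₁ + i * (e + e')))) 1
        (coresLe (W.torsionGaloisModule ((p : ℤ) ^ j)).toTopRep hle (κ.isOpen_layerSubgroup _)
          (cohomologyMap (subgroupRepHom (toTopRepHom (W.torsionGaloisModule ((p : ℤ) ^ N))
            (W.torsionGaloisModule ((p : ℤ) ^ j)) r) (κ.layerSubgroup (m₁ + (i + 1) * (e + e')))) 1 b))) =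
      resH1Hom (N := W.geomPrimaryTorsion p) (subgroupInclusion (le_refl _))
        (AddSubgroup.inclusion (AcSigned.geomTorsion_zpow_le_geomPrimaryTorsion W p (j + e))) (fun _ _ ↦ rfl)
        (coresLe (W.torsionGaloisModule ((p : ℤ) ^ (j + e))).toTopRep hle (κ.isOpen_layerSubgroup _)
          (resLe (W.torsionGaloisModule ((p : ℤ) ^ (j + e))).toTopRep hle 1 yflat)) := by
    rw [cohomologyMap_coresLe hle (κ.isOpen_layerSubgroup _) (subgroupRepHom ι' (κ.layerSubgroup (m₁ + i * (e + e')))),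
      restrictHomOfLe_subgroupRepHom, push_coresLe W p hle _ (j + e) ιje hιje, push_coresLe W p hle _ (j + e) ιje hιje, h9]
  have h11' := coresLe_resLe_eq_nsmul W p hle (κ.isOpen_layerSubgroup _) (j + e) yflat
    (hidx.trans (by rw [pow_add, mul_comm] : p ^ (e + e') = p ^ e' * p ^ e))
  /- ### (12) `p^e y♭ ≡ ι'_* y_j` -/
  have h12 : resH1Hom (N := W.geomPrimaryTorsion p) (subgroupInclusion (le_refl _))
      (AddSubgroup.inclusion (AcSigned.geomTorsion_zpow_le_geomPrimaryTorsion W p (j + e))) (fun _ _ ↦ rfl) (p ^ e • yflat) =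
      resH1Hom (N := W.geomPrimaryTorsion p) (subgroupInclusion (le_refl _))
        (AddSubgroup.inclusion (AcSigned.geomTorsion_zpow_le_geomPrimaryTorsion W p j)) (fun _ _ ↦ rfl) yj := by
    have hexp : p ^ e * p ^ (N - (c' + f + c₀) - j) = p ^ (N - (c' + f + c₀) - j + e) := by
      rw [← pow_add]; congr 1; omega
    rw [push_nsmul, hyflat, hyj, ← mul_nsmul' Y (p ^ e) (p ^ (N - (c' + f + c₀) - j)), hexp]
  /- ### (13) `W_n = cor_{n*→n} (r_* b) − p^{e'} y_j` has push `0`, hence is principal -/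
  have h13 := push_sub_eq_zero_of_pushes W p (κ.layerSubgroup (m₁ + i * (e + e'))) ι' hι'
    (coresLe (W.torsionGaloisModule ((p : ℤ) ^ j)).toTopRep hle (κ.isOpen_layerSubgroup _)
      (cohomologyMap (subgroupRepHom (toTopRepHom (W.torsionGaloisModule ((p : ℤ) ^ N))
        (W.torsionGaloisModule ((p : ℤ) ^ j)) r) (κ.layerSubgroup (m₁ + (i + 1) * (e + e')))) 1 b))
    yj yflat (p ^ e') (p ^ e) (h11.trans (congrArg _ h11')) h12
  set Wn : W.torsionH1Over ((p : ℤ) ^ j) (κ.layerSubgroup (m₁ + i * (e + e'))) :=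
    @HSub.hSub (W.torsionH1Over ((p : ℤ) ^ j) (κ.layerSubgroup (m₁ + i * (e + e'))))
      (W.torsionH1Over ((p : ℤ) ^ j) (κ.layerSubgroup (m₁ + i * (e + e'))))
      (W.torsionH1Over ((p : ℤ) ^ j) (κ.layerSubgroup (m₁ + i * (e + e')))) instHSub
      (coresLe (W.torsionGaloisModule ((p : ℤ) ^ j)).toTopRep hle (κ.isOpen_layerSubgroup _)
        (cohomologyMap (subgroupRepHom (toTopRepHom (W.torsionGaloisModule ((p : ℤ) ^ N))
          (W.torsionGaloisModule ((p : ℤ) ^ j)) r) (κ.layerSubgroup (m₁ + (i + 1) * (e + e')))) 1 b))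
      (p ^ e' • yj) with hWn
  obtain ⟨g, hg⟩ := oneCocycleClass_surjective (discreteTopRep (κ.layerSubgroup (m₁ + i * (e + e'))) (W.geomTorsion ((p : ℤ) ^ j))) Wn
  rw [← hg] at h13
  obtain ⟨Q, hQ⟩ := (push_eq_zero_iff_exists W p (κ.layerSubgroup (m₁ + i * (e + e'))) j g).1 h13
  have h14 : cores (W.torsionGaloisModule ((p : ℤ) ^ j)).toTopRep (κ.layerSubgroup (m₁ + i * (e + e'))) (κ.isOpen_layerSubgroup _)
      (oneCocycleClass (discreteTopRep (κ.layerSubgroup (m₁ + i * (e + e'))) (W.geomTorsion ((p : ℤ) ^ j))) g) = 0 :=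
    hm₁ (m₁ + i * (e + e')) (Nat.le_add_right _ _) j ιj hιj g Q hQ
  /- ### (14) `p^{e'} · cor_{Γ_n → Γ_ℚ} y_j = 0`: its push is `p^{d+e} · cor Y = 0` (§2), so it is principal over `ℚ` and killed by `p^{e'}` -/
  have h15a : cohomologyMap ιj 1 (cores (W.torsionGaloisModule ((p : ℤ) ^ j)).toTopRep (κ.layerSubgroup (m₁ + i * (e + e')))
      (κ.isOpen_layerSubgroup _) yj) = 0 := by
    obtain ⟨d', hd'⟩ := Nat.exists_eq_add_of_le (show e₂ ≤ N - (c' + f + c₀) - j + e by omega)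
    rw [cohomologyMap_cores, ← push_eq_cohomologyMap W p _ j ιj hιj yj, hyj]
    refine (map_nsmul (cores (discreteTopRep (absoluteGaloisGroup ℚ) (W.geomPrimaryTorsion p))
      (κ.layerSubgroup (m₁ + i * (e + e'))) (κ.isOpen_layerSubgroup _)) _ _).trans ?_
    rw [hd', pow_add, mul_comm (p ^ e₂) (p ^ d'), mul_nsmul', he₂ _ Y hYsel, nsmul_zero]
  have h15 : p ^ e' • cores (W.torsionGaloisModule ((p : ℤ) ^ j)).toTopRep (κ.layerSubgroup (m₁ + i * (e + e')))
      (κ.isOpen_layerSubgroup _) yj = 0 :=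
    pow_nsmul_eq_zero_of_cohomologyMap_primary_eq_zero W p κ he' j ιj hιj _ h15a
  /- ### (15) conclusion: `cor_{n*→0} = cor_{n→0} ∘ cor_{n*→n}` -/
  rw [← cores_coresLe_eq_cores (W.torsionGaloisModule ((p : ℤ) ^ j)).toTopRep hle (κ.isOpen_layerSubgroup _)
    (κ.isOpen_layerSubgroup _)]
  have hsplit : (coresLe (W.torsionGaloisModule ((p : ℤ) ^ j)).toTopRep hle (κ.isOpen_layerSubgroup _)
      (cohomologyMap (subgroupRepHom (toTopRepHom (W.torsionGaloisModule ((p : ℤ) ^ N))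
        (W.torsionGaloisModule ((p : ℤ) ^ j)) r) (κ.layerSubgroup (m₁ + (i + 1) * (e + e')))) 1 b) :
      W.torsionH1Over ((p : ℤ) ^ j) (κ.layerSubgroup (m₁ + i * (e + e')))) =
      oneCocycleClass (discreteTopRep (κ.layerSubgroup (m₁ + i * (e + e'))) (W.geomTorsion ((p : ℤ) ^ j))) g + p ^ e' • yj := by
    rw [hg, hWn, sub_add_cancel]
  rw [hsplit]
  refine (map_add (cores (W.torsionGaloisModule ((p : ℤ) ^ j)).toTopRep (κ.layerSubgroup (m₁ + i * (e + e')))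
    (κ.isOpen_layerSubgroup _)) _ _).trans ?_
  rw [h14, zero_add]
  exact (map_nsmul (cores (W.torsionGaloisModule ((p : ℤ) ^ j)).toTopRep (κ.layerSubgroup (m₁ + i * (e + e')))
    (κ.isOpen_layerSubgroup _)) _ _).trans h15

end Schedule

end TorsionEulerChar.B6

end Summit.BirchSwinnertonDyer.BirchSwinnertonDyer.Theorems

end
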